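import Literature.Analysis.FluidPDE.HardSphereCollisionRecord
import Literature.Analysis.FluidPDE.HardSphereFlowGroup
import Literature.Analysis.FluidPDE.HardSphereWindowCount
import Literature.Analysis.FluidPDE.HardSphereFlowMeasurable
import HarnessLib

/-!
# Collision pair sums along a hard-sphere flow are almost-everywhere measurable

Input `AEM` of the assembly `hardSphereCampbellFormula_dim_of` of the stationary collision-rate
(Campbell / special-flow) identity `HardSphereCampbellFormula` (Cercignani–Illner–Pulvirenti 1994,
App. 4.A): for a hard-sphere flow structure `Φ` on the torus (`0 < ε < 1/2`) and a measurable mark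
`g ≥ 0` of (configuration, ordered pair), the marked collision sum over the window `(0, τ]`,
`z ↦ Φ.collisionPairSum (Ioc 0 τ) g z`, is a.e.-measurable for the Liouville measure.

The proof is Alexander's collision-by-collision dictionary: on the good set the orbit of `z` is the
algorithmic orbit (`IsHardSphereTrajectory.stateAfter_eq_apply`, `fwdFlow_apply_zero`), its collision
times in `(0, τ]` are exactly the instants `t_{m+1}`, `m < collisionCount z τ`, at which the orbit sits
at the post-collisional states `stateAfter z (m + 1)` (`collisionPairSum_eq_sum_stateAfter`); the
resulting finite sum of measurable functions of `z` (`Alexander.measurable_stateAfter`,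
`Alexander.measurable_collisionCount`) is measurable, and the good set is conull.

## References

* C. Cercignani, R. Illner, M. Pulvirenti, *The Mathematical Theory of Dilute Gases*, Springer
  (1994), §4.2, App. 4.A pp. 107–111.
* I. Gallagher, L. Saint-Raymond, B. Texier, *From Newton to Boltzmann*, EMS (2013), Prop. 4.1.1.
-/

open MeasureTheory Set Function Filter
open scoped ENNReal

namespace Literature.MathematicalPhysics.KineticTheory

open Literature.Analysis.FluidPDE

noncomputable section

/-! ## The dictionary along one trajectory -/

section Pathwise

variable {d : Type*} [Fintype d] {X : Type*} {N : ℕ} {G : Geometry d X} {ε : ℝ}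
  [TopologicalSpace X] [T2Space X]

/-- **Collision pair sums through Alexander's enumeration.** For a hard-sphere trajectory `γ` in a
regular Hausdorff geometry and `t ≥ 0`, the collision pair sum over `(0, t]` of a time-independent
mark `g` (read on the current configuration) is the sum over `m < collisionCount (γ 0) t` of the
contact-pair sums of `g` at the post-collisional states `stateAfter (γ 0) (m + 1)`: the instants
`t_{m+1}`, `m < collisionCount`, are exactly the collision times of `γ` in `(0, t]` (they are distinct,
`t_1 = τ(γ 0) > 0`, contacts of the right-continuous orbit happen only at instants), and
`γ (t_{m+1}) = stateAfter (γ 0) (m + 1)`. [cite: CIP1994, App. 4.A pp. 107–111] -/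
theorem collisionPairSum_eq_sum_stateAfter {M : Type*} [AddCommMonoid M]
    (hG : G.IsHardSphereRegular ε) {γ : ℝ → Config N d X} (hγ : IsHardSphereTrajectory G ε N γ)
    {t : ℝ} (ht : 0 ≤ t) (g : Config N d X → Fin N → Fin N → M) :
    collisionPairSum G ε γ (Ioc 0 t) (fun s i j => g (γ s) i j) =
      ∑ m ∈ Finset.range (Alexander.collisionCount G ε (γ 0) t),
        ∑ p ∈ contactPairs G ε (Alexander.stateAfter G ε (γ 0) (m + 1)),
          g (Alexander.stateAfter G ε (γ 0) (m + 1)) p.1 p.2 := by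
  classical
  set K := Alexander.collisionCount G ε (γ 0) t with hKdef
  set sm : ℕ → ℝ := fun m => (Alexander.collisionInstant G ε (γ 0) (m + 1)).toReal with hsmdef
  have hfinT : (collisionTimes G ε γ ∩ Ioc 0 t).Finite :=
    hγ.finite_collisionTimes_inter_of_subset_Icc Ioc_subset_Icc_self
  rw [collisionPairSum_eq_finset_sum hfinT]
  have hfwd : Alexander.FwdGood G ε (γ 0) := hγ.fwdGood_apply_zero hG
  have hle : ∀ m, m < K → Alexander.collisionInstant G ε (γ 0) (m + 1) ≤ ENNReal.ofReal t :=
    fun m hm => (Alexander.le_collisionCount_iff hfwd).1 (Nat.succ_le_of_lt hm)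
  have hfin : ∀ m, m < K → Alexander.collisionInstant G ε (γ 0) (m + 1) ≠ ∞ :=
    fun m hm => ne_top_of_le_ne_top ENNReal.ofReal_ne_top (hle m hm)
  have hst : ∀ m, m < K →
      Alexander.stateAfter G ε (γ 0) (m + 1) = γ (sm m) ∧ sm m ∈ collisionTimes G ε γ :=
    fun m hm => ⟨(hγ.stateAfter_eq_apply hG (hfin m hm)).1,
      (hγ.stateAfter_eq_apply hG (hfin m hm)).2 (Nat.succ_pos m)⟩
  -- the instants are positive
  have hpos : ∀ m, m < K → 0 < sm m := by
    intro m hm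
    refine ENNReal.toReal_pos (ne_of_gt ?_) (hfin m hm)
    calc (0 : ℝ≥0∞) < Alexander.freeExitTime G ε (γ 0) := hγ.freeExitTime_apply_pos hG 0
      _ = Alexander.collisionInstant G ε (γ 0) 1 := (Alexander.collisionInstant_one _).symm
      _ ≤ Alexander.collisionInstant G ε (γ 0) (m + 1) :=
          Alexander.monotone_collisionInstant _ (Nat.succ_le_succ (Nat.zero_le m))
  -- the instants are distinct
  have hlt_of_lt : ∀ m₁ m₂, m₂ < K → m₁ < m₂ → sm m₁ < sm m₂ := by
    intro m₁ m₂ hm₂ h12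
    have hmono : Alexander.collisionInstant G ε (γ 0) (m₁ + 1 + 1) ≤
        Alexander.collisionInstant G ε (γ 0) (m₂ + 1) :=
      Alexander.monotone_collisionInstant _ (by omega)
    have hfin₁ : Alexander.collisionInstant G ε (γ 0) (m₁ + 1) ≠ ∞ :=
      ne_top_of_le_ne_top (hfin m₂ hm₂)
        ((Alexander.monotone_collisionInstant _ (Nat.le_succ _)).trans hmono)
    have hlt : Alexander.collisionInstant G ε (γ 0) (m₁ + 1) <
        Alexander.collisionInstant G ε (γ 0) (m₂ + 1) :=
      (hfwd.collisionInstant_lt_succ hG (Nat.succ_pos m₁) hfin₁).trans_le hmono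
    exact (ENNReal.toReal_lt_toReal hfin₁ (hfin m₂ hm₂)).2 hlt
  have hinj : ∀ m₁ ∈ Finset.range K, ∀ m₂ ∈ Finset.range K, sm m₁ = sm m₂ → m₁ = m₂ := by
    intro m₁ hm₁ m₂ hm₂ heq
    rw [Finset.mem_range] at hm₁ hm₂
    rcases lt_trichotomy m₁ m₂ with h | h | h
    · exact absurd heq (hlt_of_lt m₁ m₂ hm₂ h).ne
    · exact h
    · exact absurd heq (hlt_of_lt m₂ m₁ hm₁ h).ne'
  -- the instants `t_{m+1}`, `m < K`, are exactly the collision times in `(0, t]`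
  have himage : (Finset.range K).image sm = hfinT.toFinset := by
    ext s
    rw [Finset.mem_image, Set.Finite.mem_toFinset]
    constructor
    · rintro ⟨m, hm, rfl⟩
      rw [Finset.mem_range] at hm
      exact ⟨(hst m hm).2, hpos m hm, ENNReal.toReal_le_of_le_ofReal ht (hle m hm)⟩
    · rintro ⟨hs, hs0, hst'⟩
      obtain ⟨i, j, hij, hc⟩ := mem_collisionTimes.1 hs
      rw [← hγ.fwdFlow_apply_zero hG hs0.le] at hc
      obtain ⟨-, k, hk, hks⟩ := hfwd.mem_instantSet_of_fwdFlow_mem_contactSet hs0 hij hc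
      obtain ⟨m, rfl⟩ := Nat.exists_eq_succ_of_ne_zero hk.ne'
      refine ⟨m, Finset.mem_range.2
        (Nat.lt_of_succ_le ((Alexander.le_collisionCount_iff hfwd).2 ?_)), ?_⟩
      · rw [hks]
        exact ENNReal.ofReal_le_ofReal hst'
      · show (Alexander.collisionInstant G ε (γ 0) (m + 1)).toReal = s
        rw [hks, ENNReal.toReal_ofReal hs0.le]
  -- summation over `m < K`, reindexed by the (distinct) instants
  symm
  calc (∑ m ∈ Finset.range K, ∑ p ∈ contactPairs G ε (Alexander.stateAfter G ε (γ 0) (m + 1)),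
          g (Alexander.stateAfter G ε (γ 0) (m + 1)) p.1 p.2)
      = ∑ m ∈ Finset.range K, ∑ p ∈ contactPairs G ε (γ (sm m)), g (γ (sm m)) p.1 p.2 :=
        Finset.sum_congr rfl fun m hm => by rw [(hst m (Finset.mem_range.1 hm)).1]
    _ = ∑ s ∈ (Finset.range K).image sm, ∑ p ∈ contactPairs G ε (γ s), g (γ s) p.1 p.2 :=
        (Finset.sum_image (f := fun s => ∑ p ∈ contactPairs G ε (γ s), g (γ s) p.1 p.2) hinj).symm
    _ = ∑ s ∈ hfinT.toFinset, ∑ p ∈ contactPairs G ε (γ s), g (γ s) p.1 p.2 := by rw [himage]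

end Pathwise

/-! ## Along a hard-sphere flow on the torus -/

section Flow

variable {d : Type*} [Fintype d] {N : ℕ} {ε : ℝ}

/-- **The dictionary along the flow**: on the good set, the collision pair sum over `(0, t]` of a
time-independent mark is Alexander's enumerated sum started at `z`. [folklore] -/
theorem collisionPairSum_flow_eq_sum_stateAfter {M : Type*} [AddCommMonoid M] (hε' : ε < 2⁻¹)
    (Φ : HardSphereFlow (Torus.geometry d) ε N) {z : Config N d (UnitAddTorus d)} (hz : z ∈ Φ.good)
    {t : ℝ} (ht : 0 ≤ t) (g : Config N d (UnitAddTorus d) → Fin N → Fin N → M) :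
    Φ.collisionPairSum (Ioc 0 t) (fun _ w i j => g w i j) z =
      ∑ m ∈ Finset.range (Alexander.collisionCount (Torus.geometry d) ε z t),
        ∑ p ∈ contactPairs (Torus.geometry d) ε (Alexander.stateAfter (Torus.geometry d) ε z (m + 1)),
          g (Alexander.stateAfter (Torus.geometry d) ε z (m + 1)) p.1 p.2 := by
  have hG := Torus.isHardSphereRegular_geometry (d := d) hε'
  have hγ : IsHardSphereTrajectory (Torus.geometry d) ε N fun s => Φ.flow s z := Φ.isTrajectory z hz
  have h0 : Φ.flow 0 z = z := Φ.flow_zero z hz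
  have h := collisionPairSum_eq_sum_stateAfter hG hγ ht g
  beta_reduce at h
  rw [h0] at h
  exact h

/-- The enumerated sum is a measurable function of the initial datum (each summand is a
measurable function of `stateAfter z (m + 1)`, and `collisionCount z t` is measurable). [folklore] -/
theorem campbell_measurable_sum_stateAfter (hε' : ε < 2⁻¹) (t : ℝ)
    {g : Config N d (UnitAddTorus d) → Fin N → Fin N → ℝ≥0∞} (hg : ∀ i j, Measurable fun w => g w i j) :
    Measurable fun z : Config N d (UnitAddTorus d) =>
      ∑ m ∈ Finset.range (Alexander.collisionCount (Torus.geometry d) ε z t),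
        ∑ p ∈ contactPairs (Torus.geometry d) ε (Alexander.stateAfter (Torus.geometry d) ε z (m + 1)),
          g (Alexander.stateAfter (Torus.geometry d) ε z (m + 1)) p.1 p.2 := by
  classical
  have hG := Torus.isHardSphereRegular_geometry (d := d) hε'
  have hGm : (Torus.geometry d).IsMeasurable := Torus.isMeasurable_geometry
  -- each enumerated summand is measurable
  have hF : ∀ m : ℕ, Measurable fun z : Config N d (UnitAddTorus d) =>
      ∑ p ∈ contactPairs (Torus.geometry d) ε (Alexander.stateAfter (Torus.geometry d) ε z (m + 1)),
        g (Alexander.stateAfter (Torus.geometry d) ε z (m + 1)) p.1 p.2 := by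
    intro m
    have hS := Alexander.measurable_stateAfter (N := N) hG hGm (m + 1)
    have heq : (fun z : Config N d (UnitAddTorus d) =>
        ∑ p ∈ contactPairs (Torus.geometry d) ε (Alexander.stateAfter (Torus.geometry d) ε z (m + 1)),
          g (Alexander.stateAfter (Torus.geometry d) ε z (m + 1)) p.1 p.2) =
        fun z => ∑ p : Fin N × Fin N,
          if p ∈ contactPairs (Torus.geometry d) ε (Alexander.stateAfter (Torus.geometry d) ε z (m + 1))
          then g (Alexander.stateAfter (Torus.geometry d) ε z (m + 1)) p.1 p.2 else 0 := by
      funext z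
      rw [Finset.sum_ite_mem, Finset.univ_inter]
    rw [heq]
    refine Finset.measurable_sum _ fun p _ => Measurable.ite ?_ ((hg p.1 p.2).comp hS) measurable_const
    have hset : {z : Config N d (UnitAddTorus d) |
        p ∈ contactPairs (Torus.geometry d) ε (Alexander.stateAfter (Torus.geometry d) ε z (m + 1))} =
        (fun z => Alexander.stateAfter (Torus.geometry d) ε z (m + 1)) ⁻¹'
          {w | p.1 ≠ p.2 ∧ w ∈ contactSet (Torus.geometry d) N ε p.1 p.2} := by
      ext z
      simp only [mem_setOf_eq, mem_preimage, mem_contactPairs]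
    rw [hset]
    refine hS ?_
    by_cases hp : p.1 = p.2
    · have : {w : Config N d (UnitAddTorus d) | p.1 ≠ p.2 ∧ w ∈ contactSet (Torus.geometry d) N ε p.1 p.2} = ∅ := by
        ext w; simp [hp]
      rw [this]
      exact MeasurableSet.empty
    · have : {w : Config N d (UnitAddTorus d) | p.1 ≠ p.2 ∧ w ∈ contactSet (Torus.geometry d) N ε p.1 p.2} =
          contactSet (Torus.geometry d) N ε p.1 p.2 := by
        ext w; simp [hp]
      rw [this]
      exact measurableSet_contactSet _ Torus.measurable_geometry_sepVec N ε p.1 p.2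
  -- the count is measurable; write the sum as a series of `ite`s
  have hK := Alexander.measurable_collisionCount (N := N) hG hGm t
  have heq : (fun z : Config N d (UnitAddTorus d) =>
      ∑ m ∈ Finset.range (Alexander.collisionCount (Torus.geometry d) ε z t),
        ∑ p ∈ contactPairs (Torus.geometry d) ε (Alexander.stateAfter (Torus.geometry d) ε z (m + 1)),
          g (Alexander.stateAfter (Torus.geometry d) ε z (m + 1)) p.1 p.2) =
      fun z => ∑' m : ℕ, if m < Alexander.collisionCount (Torus.geometry d) ε z t then
        ∑ p ∈ contactPairs (Torus.geometry d) ε (Alexander.stateAfter (Torus.geometry d) ε z (m + 1)),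
          g (Alexander.stateAfter (Torus.geometry d) ε z (m + 1)) p.1 p.2 else 0 := by
    funext z
    rw [tsum_eq_sum (s := Finset.range (Alexander.collisionCount (Torus.geometry d) ε z t))]
    · exact Finset.sum_congr rfl fun m hm => by rw [if_pos (Finset.mem_range.1 hm)]
    · intro m hm
      rw [if_neg (fun h => hm (Finset.mem_range.2 h))]
  rw [heq]
  simp_rw [ENNReal.tsum_eq_iSup_sum]
  refine Measurable.iSup fun s => Finset.measurable_sum s fun m _ => ?_
  exact Measurable.ite (hK (measurableSet_lt measurable_const measurable_id)) (hF m) measurable_const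

/-- **`AEM`: collision pair sums along a hard-sphere flow on the torus are a.e.-measurable.** For
`0 < ε < 1/2`, a hard-sphere flow structure `Φ` on `(T^d × ℝ^d)^N`, a measurable mark `g ≥ 0` and a
window `(0, τ]`, `z ↦ Φ.collisionPairSum (Ioc 0 τ) g z` is a.e.-measurable for the Liouville measure
(it agrees on the conull good set with Alexander's enumerated sum, a measurable function).
[cite: CIP1994, App. 4.A pp. 107–111] -/
theorem aemeasurable_collisionPairSum (hε : 0 < ε) (hε' : ε < 1 / 2)
    (Φ : HardSphereFlow (Torus.geometry d) ε N)
    (g : Config N d (UnitAddTorus d) → Fin N → Fin N → ℝ≥0∞) (hg : ∀ i j, Measurable fun w => g w i j)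
    (τ : ℝ) :
    AEMeasurable (Φ.collisionPairSum (Ioc 0 τ) (fun _ w i j => g w i j))
      (liouville (Torus.geometry d) N ε) := by
  have _ := hε
  have hε2 : ε < 2⁻¹ := by rw [inv_eq_one_div]; exact hε'
  rcases le_or_gt τ 0 with hτ | hτ
  · have h0 : Φ.collisionPairSum (Ioc 0 τ) (fun _ w i j => g w i j) = fun _ => 0 := by
      funext z
      unfold HardSphereFlow.collisionPairSum
      rw [Ioc_eq_empty (not_lt.2 hτ), collisionPairSum_empty]
    rw [h0]
    exact aemeasurable_const
  · refine (campbell_measurable_sum_stateAfter hε2 τ hg).aemeasurable.congr ?_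
    filter_upwards [Φ.ae_mem_good] with z hz
    exact (collisionPairSum_flow_eq_sum_stateAfter hε2 Φ hz hτ.le g).symm

end Flow

end

end Literature.MathematicalPhysics.KineticTheory
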